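import Summits.QuantumFields.BalabanUV.T4Continuum.Support.ShellMeasureAverageDerivative

/-!
# `T4Continuum.ShellMeasureAverageDerivativeChart` — row S48, THE CONCRETE CHART: extension by zero ∕ restriction on
# the fine fields near a coarse bond `E_c := ↥(qppBonds L c) → 𝔸` (sup norm), and S48's three deliverables for ANY
# chart average `Φ` with `Φ v = Q̃_V(ext v)(c)` analytic on a ball — the shape row S49 file 2 lands
(cell `pub-balaban`, sub-cell `t4`, spine estimate NE7c (node U5b); NE7c ROUND-2 crew `t4-ne7c-formalise-*`, seat
`b2b-balaban-t4-ne7c-formalise-leaf-03` (gen 3); row S48 of `t4/b2b-balaban-t4-ne7c-p1/LEAVES-NE7c-P1.md` v2.0 (WALL §3 W-d,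
ANALYTIC HALF for the PRINTED average [B12] (2.4) ∕ [B7] (15)); ADDITIVE — imports this seat's generic S48 file
`ShellMeasureAverageDerivative` ONLY; 0 sorry, 0 cite)

HONEST FRAMING.  Finite four-torus programme, rung (B)+1 only — NOT infinite volume, NOT a mass gap, NOT the Clay
problem, NOT summit progress; (B), `BetaPertHyp`, (B^μ) are not consumed.  NE7c NOT PRINTED, NOT PROVED; «NE7c ⇐ the
named binders» (c3); NOTHING in the countdown moves.  CALCULUS ∕ BOOKKEEPING on the PRINTED formula (2.4)∕(15) as
typed in `B12AverageCorridor267`; the analyticity of the chart average is row S49's theorem (owner) and enters here as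
the binder `AnalyticOnNhd ℂ Φ (ball 0 R)` (or `HasFDerivAt Φ A 0`); nothing of Bałaban's estimates; no `def … : Prop`.
HONEST DEPENDENCY (cell, verbatim): continuum YM on T⁴ ⇐ BetaPertH ∧ nine spine estimates (0/9 proved); BetaPertH ⇐
(D1) ∧ (D4) ∧ CAP+tail; G-an2-4 gates asym, D1 and NE2/3/4.

CONTENT.
* §1 THE CHART (data, [folklore]): `extQ L c v` = the configuration equal to `v` on `qppBonds L c` and `0` elsewhere;
  `resQ L c B′ = B′|_{qppBonds L c}`; `extQ_apply_mem`, `extQ_smul`, `extQ_resQ` (`extQ (resQ B′)` agrees with `B′` on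
  `qppBonds L c`), `resQ_add`∕`resQ_smul` (definitional), `resQ_single` (`resQ (δ_{b₀(c)} Y) = δ_{⟨b₀(c), _⟩} Y`),
  `norm_resQ_single_le` (`‖resQ (δ_{b₀(c)} Y)‖ ≤ ‖Y‖`, sup norm), `Qtilde_extQ_resQ` (`Q̃_V(extQ (resQ B′))(c) =
  Q̃_V(B′)(c)`, locality), `Qtilde_ext_eq_of_agree` (ANY extension `ext′ v` agreeing with `v` on `qppBonds L c` has
  `Q̃_V(ext′ v)(c) = Q̃_V(extQ v)(c)` — so row S49's own `ext` may differ from `extQ` off the two blocks).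
* §2 S48 (i)–(iii) ON THE CHART, for ANY `Φ : E_c → 𝔸` with `Φ v = Q̃_V(extQ v)(c)` and `HasFDerivAt Φ A 0`:
  **`fderiv_chart_apply_eq_LQ`** (`A v = LQ L 𝒯 V (extQ v) c` — (i): the `deriv`-typed «LQ̃» IS `DQ̃(0)`),
  **`LQ_eq_fderiv_resQ`** (`LQ L 𝒯 V B′ c = A (resQ B′)` for EVERY configuration), **`LQ_add_chart`**∕**`LQ_smul_chart`**
  ((ii): «LQ̃» additive and `ℂ`-homogeneous at `c`), **`fderiv_chart_hopC`** ((iii): `A (hopC X) = X` — p. 267's `h` is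
  a right inverse of `DQ̃(0)`; S46's `hLQh`), `norm_hopC_chart_le` (S46's `hHop`), with `hopC` the `ℂ`-linear map of
  the generic file at `res := resQ L c`; `fderiv_chart_single_hGen` (`A (δ_{⟨b₀(c),_⟩} (hGen c X)) = X`).
* §3 AT THE OWNER'S INTERIM HYPOTHESIS `hQ : AnalyticAt ℂ (fun B => Qtilde L 𝒯 V (Function.extend Subtype.val B 0) c) 0`
  (journal l.13375; row S49 file 2's `analyticOnNhd_Qtilde … (mem_ball_self …)` discharges it): the three deliverables
  of the row LITERALLY — **`fderiv_Qtilde_chart_zero_apply`** (i), **`LQ_add_of_analyticAt`**∕**`LQ_smul_of_analyticAt`**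
  (ii), **`fderiv_Qtilde_chart_zero_hopC`** (iii) —, plus the ball forms `hasFDerivAt_of_analyticOnNhd_ball`,
  `fderiv_zero_apply_eq_LQ_of_analytic`, `fderiv_zero_hopC_of_analytic`.
WHAT THIS DOES NOT DO.  No analyticity proved (S49); no real structure (S47); no linearizing chart (S46); NE7c NOT
proved; 0/9 spine.
-/

noncomputable section

open Finset Function Metric
open scoped Topology

namespace Summit.QuantumFields.BalabanUV.T4Continuum.ShellMeasureAverageDerivativeChart

open Literature.MathematicalPhysics.QuantumFieldTheory.Balaban1983to89
open Literature.MathematicalPhysics.QuantumLattice (ZdEdge)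
open B7BlockGeometry (qppBonds)
open B13PkLocalTerms (hOp)
open B13CorridorSeparation (b0Z b0Z_injective b0Z_mem_qppBonds)
open B12HOperator267 (IsQppLocal bcoef)
open B12AverageCorridor267
open ShellMeasureAverageDerivative

variable {d : ℕ}

/-! ## §1 The chart: extension by zero and restriction near a coarse bond -/

section Chart

variable {𝔸 : Type*} [NormedRing 𝔸] [NormedAlgebra ℂ 𝔸] [CompleteSpace 𝔸]
variable {L : ℕ} {𝒯 : (ZdEdge d → 𝔸ˣ) → (Fin d → ℤ) → 𝔸ˣ}

/-- EXTENSION BY ZERO: the configuration equal to `v` on `qppBonds L c` (the bonds of `B(c₋) ∪ B(c₊)`) and `0`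
elsewhere — LITERALLY `Function.extend Subtype.val v 0`, the chart variable of row S49 file 2
(`ShellMeasureAverageAnalyticB7`), so that its analyticity statements are about `fun v => Q̃_V(extQ v)(c)` verbatim.
[folklore] -/
def extQ (L : ℕ) (c : ZdEdge d) (v : ↥(qppBonds L c) → 𝔸) : ZdEdge d → 𝔸 :=
  Function.extend Subtype.val v 0

omit [NormedAlgebra ℂ 𝔸] [CompleteSpace 𝔸] in
/-- unfolding (definitional): `extQ L c v = Function.extend Subtype.val v 0`. [folklore] -/
theorem extQ_eq_extend (L : ℕ) (c : ZdEdge d) (v : ↥(qppBonds L c) → 𝔸) :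
    extQ L c v = Function.extend Subtype.val v 0 := rfl

/-- RESTRICTION of a configuration to `qppBonds L c`. [folklore] -/
def resQ (L : ℕ) (c : ZdEdge d) (B : ZdEdge d → 𝔸) : ↥(qppBonds L c) → 𝔸 := fun b => B b

omit [NormedAlgebra ℂ 𝔸] [CompleteSpace 𝔸] in
/-- on the two blocks the extension is the given field. [folklore] -/
theorem extQ_apply_mem (L : ℕ) (c : ZdEdge d) (v : ↥(qppBonds L c) → 𝔸) {b : ZdEdge d}
    (hb : b ∈ qppBonds L c) : extQ L c v b = v ⟨b, hb⟩ :=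
  Subtype.val_injective.extend_apply v 0 ⟨b, hb⟩

omit [NormedAlgebra ℂ 𝔸] [CompleteSpace 𝔸] in
/-- off the two blocks the extension vanishes. [folklore] -/
theorem extQ_apply_not_mem (L : ℕ) (c : ZdEdge d) (v : ↥(qppBonds L c) → 𝔸) {b : ZdEdge d}
    (hb : b ∉ qppBonds L c) : extQ L c v b = 0 := by
  unfold extQ
  rw [Function.extend_apply' _ _ _ (fun ⟨a, ha⟩ => hb (ha ▸ a.2))]
  rfl

omit [CompleteSpace 𝔸] in
/-- the extension is `ℂ`-homogeneous. [folklore] -/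
theorem extQ_smul (L : ℕ) (c : ZdEdge d) (s : ℂ) (v : ↥(qppBonds L c) → 𝔸) :
    extQ L c (s • v) = s • extQ L c v := by
  funext b
  by_cases h : b ∈ qppBonds L c
  · rw [Pi.smul_apply, extQ_apply_mem L c _ h, extQ_apply_mem L c _ h, Pi.smul_apply]
  · rw [Pi.smul_apply, extQ_apply_not_mem L c _ h, extQ_apply_not_mem L c _ h, smul_zero]

omit [NormedAlgebra ℂ 𝔸] [CompleteSpace 𝔸] in
/-- the extension is additive. [folklore] -/
theorem extQ_add (L : ℕ) (c : ZdEdge d) (v w : ↥(qppBonds L c) → 𝔸) :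
    extQ L c (v + w) = extQ L c v + extQ L c w := by
  funext b
  by_cases h : b ∈ qppBonds L c
  · rw [Pi.add_apply, extQ_apply_mem L c _ h, extQ_apply_mem L c _ h, extQ_apply_mem L c _ h, Pi.add_apply]
  · rw [Pi.add_apply, extQ_apply_not_mem L c _ h, extQ_apply_not_mem L c _ h, extQ_apply_not_mem L c _ h,
      add_zero]

omit [NormedAlgebra ℂ 𝔸] [CompleteSpace 𝔸] in
/-- `extQ (resQ B′)` agrees with `B′` on `qppBonds L c` (the hypothesis `hres` of the generic file). [folklore] -/
theorem extQ_resQ (L : ℕ) (c : ZdEdge d) (B' : ZdEdge d → 𝔸) :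
    ∀ b ∈ qppBonds L c, extQ L c (resQ L c B') b = B' b := fun b hb => by
  rw [extQ_apply_mem L c _ hb]; rfl

omit [NormedAlgebra ℂ 𝔸] [CompleteSpace 𝔸] in
/-- `resQ (extQ v) = v`. [folklore] -/
theorem resQ_extQ (L : ℕ) (c : ZdEdge d) (v : ↥(qppBonds L c) → 𝔸) : resQ L c (extQ L c v) = v := by
  funext b; unfold resQ; rw [extQ_apply_mem L c v b.2]

omit [NormedAlgebra ℂ 𝔸] [CompleteSpace 𝔸] in
/-- restriction is additive (definitionally). [folklore] -/
theorem resQ_add (L : ℕ) (c : ZdEdge d) (B₁ B₂ : ZdEdge d → 𝔸) :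
    resQ L c (B₁ + B₂) = resQ L c B₁ + resQ L c B₂ := rfl

omit [CompleteSpace 𝔸] in
/-- restriction is `ℂ`-homogeneous (definitionally). [folklore] -/
theorem resQ_smul (L : ℕ) (c : ZdEdge d) (a : ℂ) (B : ZdEdge d → 𝔸) : resQ L c (a • B) = a • resQ L c B := rfl

omit [NormedAlgebra ℂ 𝔸] [CompleteSpace 𝔸] in
/-- the restricted corridor field is the one-bond field of the chart: `resQ (δ_{b₀(c)} Y) = δ_{⟨b₀(c), _⟩} Y`.
[folklore] -/
theorem resQ_single (hL : 0 < L) (c : ZdEdge d) (Y : 𝔸) :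
    resQ L c (Pi.single (b0Z L c) Y) = Pi.single (⟨b0Z L c, b0Z_mem_qppBonds hL c⟩ : ↥(qppBonds L c)) Y := by
  funext b
  unfold resQ
  by_cases hb : b = ⟨b0Z L c, b0Z_mem_qppBonds hL c⟩
  · subst hb; simp
  · have hb' : (b : ZdEdge d) ≠ b0Z L c := fun h => hb (Subtype.ext h)
    rw [Pi.single_eq_of_ne hb', Pi.single_eq_of_ne hb]

omit [NormedAlgebra ℂ 𝔸] [CompleteSpace 𝔸] in
/-- the restriction does not increase the norm of a one-bond field (sup norm): `‖resQ (δ_{b₀(c)} Y)‖ ≤ ‖Y‖` (the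
hypothesis `hresn` of the generic file). [folklore] -/
theorem norm_resQ_single_le (L : ℕ) (c : ZdEdge d) (Y : 𝔸) : ‖resQ L c (Pi.single (b0Z L c) Y)‖ ≤ ‖Y‖ := by
  refine (pi_norm_le_iff_of_nonneg (norm_nonneg Y)).2 fun b => ?_
  unfold resQ
  by_cases hb : (b : ZdEdge d) = b0Z L c
  · simp only [hb, Pi.single_eq_same, le_refl]
  · rw [Pi.single_eq_of_ne hb, norm_zero]; exact norm_nonneg Y

/-- LOCALITY: `Q̃_V(extQ (resQ B′))(c) = Q̃_V(B′)(c)`. [folklore] -/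
theorem Qtilde_extQ_resQ (hL : 0 < L) (h𝒯 : IsBlockLocal L 𝒯) (V : ZdEdge d → 𝔸ˣ) (c : ZdEdge d)
    (B' : ZdEdge d → 𝔸) : Qtilde L 𝒯 V (extQ L c (resQ L c B')) c = Qtilde L 𝒯 V B' c :=
  Qtilde_congr hL h𝒯 V (extQ_resQ L c B')

/-- ANY extension agreeing with `v` on the two blocks gives the same `Q̃_V(·)(c)` as `extQ v` — so a chart average
defined with a different extension (e.g. row S49's own) is the `Φ` of §2 all the same. [folklore] -/
theorem Qtilde_ext_eq_of_agree (hL : 0 < L) (h𝒯 : IsBlockLocal L 𝒯) (V : ZdEdge d → 𝔸ˣ) (c : ZdEdge d)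
    {ext' : (↥(qppBonds L c) → 𝔸) → (ZdEdge d → 𝔸)}
    (hext' : ∀ v, ∀ b (hb : b ∈ qppBonds L c), ext' v b = v ⟨b, hb⟩) (v : ↥(qppBonds L c) → 𝔸) :
    Qtilde L 𝒯 V (ext' v) c = Qtilde L 𝒯 V (extQ L c v) c :=
  Qtilde_congr hL h𝒯 V fun b hb => by rw [hext' v b hb, extQ_apply_mem L c v hb]

end Chart

/-! ## §2 S48 (i)–(iii) on the chart, from a Fréchet derivative of the chart average at `0` -/

section OnChart

variable {𝔸 : Type*} [NormedRing 𝔸] [NormedAlgebra ℂ 𝔸] [NormOneClass 𝔸] [CompleteSpace 𝔸]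
variable {L : ℕ} {𝒯 : (ZdEdge d → 𝔸ˣ) → (Fin d → ℤ) → 𝔸ˣ}

omit [NormOneClass 𝔸] in
/-- **(i) THE `deriv`-TYPED «LQ̃» IS `DQ̃(0)`** on the chart: `A v = LQ L 𝒯 V (extQ v) c`. [folklore] -/
theorem fderiv_chart_apply_eq_LQ (V : ZdEdge d → 𝔸ˣ) (c : ZdEdge d) {Φ : (↥(qppBonds L c) → 𝔸) → 𝔸}
    (hΦ : ∀ v, Φ v = Qtilde L 𝒯 V (extQ L c v) c) {A : (↥(qppBonds L c) → 𝔸) →L[ℂ] 𝔸} (hF : HasFDerivAt Φ A 0)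
    (v : ↥(qppBonds L c) → 𝔸) : A v = LQ L 𝒯 V (extQ L c v) c :=
  (LQ_ext_eq (extQ L c) (extQ_smul L c) V c hΦ hF v).symm

omit [NormOneClass 𝔸] in
/-- «LQ̃» on EVERY configuration through the chart: `LQ L 𝒯 V B′ c = A (resQ B′)`. [folklore] -/
theorem LQ_eq_fderiv_resQ (hL : 0 < L) (h𝒯 : IsBlockLocal L 𝒯) (V : ZdEdge d → 𝔸ˣ) (c : ZdEdge d)
    {Φ : (↥(qppBonds L c) → 𝔸) → 𝔸} (hΦ : ∀ v, Φ v = Qtilde L 𝒯 V (extQ L c v) c)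
    {A : (↥(qppBonds L c) → 𝔸) →L[ℂ] 𝔸} (hF : HasFDerivAt Φ A 0) (B' : ZdEdge d → 𝔸) :
    LQ L 𝒯 V B' c = A (resQ L c B') :=
  LQ_eq_apply_res (extQ L c) (resQ L c) (extQ_smul L c) hL h𝒯 V c (extQ_resQ L c) hΦ hF B'

omit [NormOneClass 𝔸] in
/-- **(ii) «LQ̃» IS ADDITIVE at `c`.** [folklore] -/
theorem LQ_add_chart (hL : 0 < L) (h𝒯 : IsBlockLocal L 𝒯) (V : ZdEdge d → 𝔸ˣ) (c : ZdEdge d)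
    {Φ : (↥(qppBonds L c) → 𝔸) → 𝔸} (hΦ : ∀ v, Φ v = Qtilde L 𝒯 V (extQ L c v) c)
    {A : (↥(qppBonds L c) → 𝔸) →L[ℂ] 𝔸} (hF : HasFDerivAt Φ A 0) (B₁ B₂ : ZdEdge d → 𝔸) :
    LQ L 𝒯 V (B₁ + B₂) c = LQ L 𝒯 V B₁ c + LQ L 𝒯 V B₂ c :=
  LQ_add (extQ L c) (resQ L c) (extQ_smul L c) (resQ_add L c) hL h𝒯 V c (extQ_resQ L c) hΦ hF B₁ B₂

omit [NormOneClass 𝔸] in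
/-- **(ii) «LQ̃» IS `ℂ`-HOMOGENEOUS at `c`.** [folklore] -/
theorem LQ_smul_chart (hL : 0 < L) (h𝒯 : IsBlockLocal L 𝒯) (V : ZdEdge d → 𝔸ˣ) (c : ZdEdge d)
    {Φ : (↥(qppBonds L c) → 𝔸) → 𝔸} (hΦ : ∀ v, Φ v = Qtilde L 𝒯 V (extQ L c v) c)
    {A : (↥(qppBonds L c) → 𝔸) →L[ℂ] 𝔸} (hF : HasFDerivAt Φ A 0) (a : ℂ) (B' : ZdEdge d → 𝔸) :
    LQ L 𝒯 V (a • B') c = a • LQ L 𝒯 V B' c :=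
  LQ_smul (extQ L c) (resQ L c) (extQ_smul L c) (resQ_smul L c) hL h𝒯 V c (extQ_resQ L c) hΦ hF a B'

/-- **(iii) p. 267's `h` IS A RIGHT INVERSE OF `DQ̃(0)`** on the chart: `A (hopC X) = X` with `hopC` the `ℂ`-linear
map `X ↦ resQ (δ_{b₀(c)} (hGen c X))` of the generic file (S46's `hLQh`). [folklore] -/
theorem fderiv_chart_hopC (hL : 0 < L) (h𝒯 : IsBlockLocal L 𝒯) (h𝒯' : IsAxisStraightFamily L 𝒯)
    (V : ZdEdge d → 𝔸ˣ) {ε : ℝ} (hε0 : 0 ≤ ε) (hε : ε ≤ 1 / 8)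
    (hW : ∀ c, ∀ x ∈ offAxis L c, ‖((loopW L 𝒯 V c x : 𝔸ˣ) : 𝔸) - 1‖ ≤ ε)
    (hV : ∀ b, ‖((V b : 𝔸ˣ) : 𝔸)‖ ≤ 1) (hV' : ∀ b, ‖(((V b)⁻¹ : 𝔸ˣ) : 𝔸)‖ ≤ 1)
    (hbud : (L : ℝ) ^ d / L * (24 * ε) < 1)
    (c : ZdEdge d) {Φ : (↥(qppBonds L c) → 𝔸) → 𝔸}
    (hΦ : ∀ v, Φ v = Qtilde L 𝒯 V (extQ L c v) c) {A : (↥(qppBonds L c) → 𝔸) →L[ℂ] 𝔸}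
    (hF : HasFDerivAt Φ A 0) (X : 𝔸) :
    A (hopC (resQ L c) (resQ_add L c) (resQ_smul L c) hL h𝒯 h𝒯' V hε0 hε hW hV hV' hbud c X) = X :=
  apply_hopC (extQ L c) (resQ L c) (extQ_smul L c) (resQ_add L c) (resQ_smul L c) hL h𝒯 h𝒯' V hε0 hε hW hV hV'
    hbud c (extQ_resQ L c) hΦ hF X

/-- the one-bond form of (iii): `A (δ_{⟨b₀(c),_⟩} (hGen c X)) = X`. [folklore] -/
theorem fderiv_chart_single_hGen (hL : 0 < L) (h𝒯 : IsBlockLocal L 𝒯) (h𝒯' : IsAxisStraightFamily L 𝒯)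
    (V : ZdEdge d → 𝔸ˣ) {ε : ℝ} (hε0 : 0 ≤ ε) (hε : ε ≤ 1 / 8)
    (hW : ∀ c, ∀ x ∈ offAxis L c, ‖((loopW L 𝒯 V c x : 𝔸ˣ) : 𝔸) - 1‖ ≤ ε)
    (hV : ∀ b, ‖((V b : 𝔸ˣ) : 𝔸)‖ ≤ 1) (hV' : ∀ b, ‖(((V b)⁻¹ : 𝔸ˣ) : 𝔸)‖ ≤ 1)
    (hbud : (L : ℝ) ^ d / L * (24 * ε) < 1)
    (c : ZdEdge d) {Φ : (↥(qppBonds L c) → 𝔸) → 𝔸}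
    (hΦ : ∀ v, Φ v = Qtilde L 𝒯 V (extQ L c v) c) {A : (↥(qppBonds L c) → 𝔸) →L[ℂ] 𝔸}
    (hF : HasFDerivAt Φ A 0) (X : 𝔸) :
    A (Pi.single (⟨b0Z L c, b0Z_mem_qppBonds hL c⟩ : ↥(qppBonds L c))
      (hGen hL h𝒯' V hε0 hε hW hV hV' hbud c X)) = X := by
  rw [← resQ_single hL c]
  exact apply_res_single_hGen (extQ L c) (resQ L c) (extQ_smul L c) hL h𝒯 h𝒯' V hε0 hε hW hV hV' hbud c
    (extQ_resQ L c) hΦ hF X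

/-- S46's `hHop` on the chart: `‖hopC X‖ ≤ (Lᵈ/L)/(1 − (Lᵈ/L)·24ε)·‖X‖`. [folklore] -/
theorem norm_hopC_chart_le (hL : 0 < L) (h𝒯 : IsBlockLocal L 𝒯) (h𝒯' : IsAxisStraightFamily L 𝒯)
    (V : ZdEdge d → 𝔸ˣ) {ε : ℝ} (hε0 : 0 ≤ ε) (hε : ε ≤ 1 / 8)
    (hW : ∀ c, ∀ x ∈ offAxis L c, ‖((loopW L 𝒯 V c x : 𝔸ˣ) : 𝔸) - 1‖ ≤ ε)
    (hV : ∀ b, ‖((V b : 𝔸ˣ) : 𝔸)‖ ≤ 1) (hV' : ∀ b, ‖(((V b)⁻¹ : 𝔸ˣ) : 𝔸)‖ ≤ 1)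
    (hbud : (L : ℝ) ^ d / L * (24 * ε) < 1)
    (c : ZdEdge d) (X : 𝔸) :
    ‖hopC (resQ L c) (resQ_add L c) (resQ_smul L c) hL h𝒯 h𝒯' V hε0 hε hW hV hV' hbud c X‖ ≤
      ((L : ℝ) ^ d / L) / (1 - (L : ℝ) ^ d / L * (24 * ε)) * ‖X‖ :=
  norm_hopC_le (resQ L c) (resQ_add L c) (resQ_smul L c) hL h𝒯 h𝒯' V hε0 hε hW hV hV' hbud c
    (norm_resQ_single_le L c) X

end OnChart

/-! ## §3 From analyticity at `0` ∕ on a ball (row S49's (A)) — the owner's interim hypothesis shape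
`hQ : AnalyticAt ℂ (fun B => Qtilde L 𝒯 V (Function.extend Subtype.val B 0) c) 0` (journal l.13375) -/

section Analytic

variable {𝔸 : Type*} [NormedRing 𝔸] [NormedAlgebra ℂ 𝔸] [NormOneClass 𝔸] [CompleteSpace 𝔸]
variable {L : ℕ} {𝒯 : (ZdEdge d → 𝔸ˣ) → (Fin d → ℤ) → 𝔸ˣ}

omit [NormOneClass 𝔸] in
/-- a map analytic on a neighbourhood of every point of `ball 0 R`, `0 < R`, has the Fréchet derivative
`fderiv ℂ Φ 0` at `0`. [folklore] -/
theorem hasFDerivAt_of_analyticOnNhd_ball {E F : Type*} [NormedAddCommGroup E] [NormedSpace ℂ E]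
    [NormedAddCommGroup F] [NormedSpace ℂ F] {Φ : E → F} {R : ℝ} (hR : 0 < R)
    (hΦa : AnalyticOnNhd ℂ Φ (ball 0 R)) : HasFDerivAt Φ (fderiv ℂ Φ 0) 0 :=
  (hΦa 0 (mem_ball_self hR)).differentiableAt.hasFDerivAt

omit [NormOneClass 𝔸] in
/-- **(i) AT THE OWNER'S INTERIM HYPOTHESIS**: if `B ↦ Q̃_V(Function.extend Subtype.val B 0)(c)` is analytic at `0`
(row S49 file 2: `analyticOnNhd_Qtilde … (mem_ball_self …)`), then
`fderiv ℂ (fun B => Q̃_V(extend B)(c)) 0 v = LQ L 𝒯 V (Function.extend Subtype.val v 0) c` for EVERY direction `v`.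
[folklore] -/
theorem fderiv_Qtilde_chart_zero_apply (V : ZdEdge d → 𝔸ˣ) (c : ZdEdge d)
    (hQ : AnalyticAt ℂ (fun B : ↥(qppBonds L c) → 𝔸 => Qtilde L 𝒯 V (Function.extend Subtype.val B 0) c) 0)
    (v : ↥(qppBonds L c) → 𝔸) :
    fderiv ℂ (fun B : ↥(qppBonds L c) → 𝔸 => Qtilde L 𝒯 V (Function.extend Subtype.val B 0) c) 0 v =
      LQ L 𝒯 V (Function.extend Subtype.val v 0) c :=
  fderiv_chart_apply_eq_LQ V c (Φ := fun B => Qtilde L 𝒯 V (Function.extend Subtype.val B 0) c)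
    (fun _ => rfl) hQ.differentiableAt.hasFDerivAt v

omit [NormOneClass 𝔸] in
/-- **(ii) AT THE OWNER'S INTERIM HYPOTHESIS**: «LQ̃» is ADDITIVE at `c`. [folklore] -/
theorem LQ_add_of_analyticAt (hL : 0 < L) (h𝒯 : IsBlockLocal L 𝒯) (V : ZdEdge d → 𝔸ˣ) (c : ZdEdge d)
    (hQ : AnalyticAt ℂ (fun B : ↥(qppBonds L c) → 𝔸 => Qtilde L 𝒯 V (Function.extend Subtype.val B 0) c) 0)
    (B₁ B₂ : ZdEdge d → 𝔸) : LQ L 𝒯 V (B₁ + B₂) c = LQ L 𝒯 V B₁ c + LQ L 𝒯 V B₂ c :=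
  LQ_add_chart hL h𝒯 V c (Φ := fun B => Qtilde L 𝒯 V (Function.extend Subtype.val B 0) c) (fun _ => rfl)
    hQ.differentiableAt.hasFDerivAt B₁ B₂

omit [NormOneClass 𝔸] in
/-- **(ii) AT THE OWNER'S INTERIM HYPOTHESIS**: «LQ̃» is `ℂ`-HOMOGENEOUS at `c`. [folklore] -/
theorem LQ_smul_of_analyticAt (hL : 0 < L) (h𝒯 : IsBlockLocal L 𝒯) (V : ZdEdge d → 𝔸ˣ) (c : ZdEdge d)
    (hQ : AnalyticAt ℂ (fun B : ↥(qppBonds L c) → 𝔸 => Qtilde L 𝒯 V (Function.extend Subtype.val B 0) c) 0)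
    (a : ℂ) (B' : ZdEdge d → 𝔸) : LQ L 𝒯 V (a • B') c = a • LQ L 𝒯 V B' c :=
  LQ_smul_chart hL h𝒯 V c (Φ := fun B => Qtilde L 𝒯 V (Function.extend Subtype.val B 0) c) (fun _ => rfl)
    hQ.differentiableAt.hasFDerivAt a B'

/-- **(iii) AT THE OWNER'S INTERIM HYPOTHESIS**: p. 267's `h` is a right inverse of the Fréchet derivative —
`fderiv ℂ (fun B => Q̃_V(extend B)(c)) 0 (hopC X) = X` (S46's `hLQh` with `Qt := fun B => Q̃_V(extend B)(c)`,
`hop := hopC`). [folklore] -/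
theorem fderiv_Qtilde_chart_zero_hopC (hL : 0 < L) (h𝒯 : IsBlockLocal L 𝒯) (h𝒯' : IsAxisStraightFamily L 𝒯)
    (V : ZdEdge d → 𝔸ˣ) {ε : ℝ} (hε0 : 0 ≤ ε) (hε : ε ≤ 1 / 8)
    (hW : ∀ c, ∀ x ∈ offAxis L c, ‖((loopW L 𝒯 V c x : 𝔸ˣ) : 𝔸) - 1‖ ≤ ε)
    (hV : ∀ b, ‖((V b : 𝔸ˣ) : 𝔸)‖ ≤ 1) (hV' : ∀ b, ‖(((V b)⁻¹ : 𝔸ˣ) : 𝔸)‖ ≤ 1)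
    (hbud : (L : ℝ) ^ d / L * (24 * ε) < 1) (c : ZdEdge d)
    (hQ : AnalyticAt ℂ (fun B : ↥(qppBonds L c) → 𝔸 => Qtilde L 𝒯 V (Function.extend Subtype.val B 0) c) 0)
    (X : 𝔸) :
    fderiv ℂ (fun B : ↥(qppBonds L c) → 𝔸 => Qtilde L 𝒯 V (Function.extend Subtype.val B 0) c) 0
      (hopC (resQ L c) (resQ_add L c) (resQ_smul L c) hL h𝒯 h𝒯' V hε0 hε hW hV hV' hbud c X) = X :=
  fderiv_chart_hopC hL h𝒯 h𝒯' V hε0 hε hW hV hV' hbud c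
    (Φ := fun B => Qtilde L 𝒯 V (Function.extend Subtype.val B 0) c) (fun _ => rfl)
    hQ.differentiableAt.hasFDerivAt X

omit [NormOneClass 𝔸] in
/-- (i) from analyticity on a ball: `fderiv ℂ Φ 0 v = LQ L 𝒯 V (extQ v) c`. [folklore] -/
theorem fderiv_zero_apply_eq_LQ_of_analytic (V : ZdEdge d → 𝔸ˣ) (c : ZdEdge d)
    {Φ : (↥(qppBonds L c) → 𝔸) → 𝔸} (hΦ : ∀ v, Φ v = Qtilde L 𝒯 V (extQ L c v) c) {R : ℝ} (hR : 0 < R)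
    (hΦa : AnalyticOnNhd ℂ Φ (ball 0 R)) (v : ↥(qppBonds L c) → 𝔸) :
    fderiv ℂ Φ 0 v = LQ L 𝒯 V (extQ L c v) c :=
  fderiv_chart_apply_eq_LQ V c hΦ (hasFDerivAt_of_analyticOnNhd_ball hR hΦa) v

/-- (iii) from analyticity: `fderiv ℂ Φ 0 (hopC X) = X` — LITERALLY S46's `hLQh` binder for `Qt := Φ`,
`hop := hopC`. [folklore] -/
theorem fderiv_zero_hopC_of_analytic (hL : 0 < L) (h𝒯 : IsBlockLocal L 𝒯) (h𝒯' : IsAxisStraightFamily L 𝒯)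
    (V : ZdEdge d → 𝔸ˣ) {ε : ℝ} (hε0 : 0 ≤ ε) (hε : ε ≤ 1 / 8)
    (hW : ∀ c, ∀ x ∈ offAxis L c, ‖((loopW L 𝒯 V c x : 𝔸ˣ) : 𝔸) - 1‖ ≤ ε)
    (hV : ∀ b, ‖((V b : 𝔸ˣ) : 𝔸)‖ ≤ 1) (hV' : ∀ b, ‖(((V b)⁻¹ : 𝔸ˣ) : 𝔸)‖ ≤ 1)
    (hbud : (L : ℝ) ^ d / L * (24 * ε) < 1) (c : ZdEdge d)
    {Φ : (↥(qppBonds L c) → 𝔸) → 𝔸} (hΦ : ∀ v, Φ v = Qtilde L 𝒯 V (extQ L c v) c) {R : ℝ} (hR : 0 < R)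
    (hΦa : AnalyticOnNhd ℂ Φ (ball 0 R)) :
    ∀ X, fderiv ℂ Φ 0 (hopC (resQ L c) (resQ_add L c) (resQ_smul L c) hL h𝒯 h𝒯' V hε0 hε hW hV hV' hbud c X) = X :=
  fun X => fderiv_chart_hopC hL h𝒯 h𝒯' V hε0 hε hW hV hV' hbud c hΦ (hasFDerivAt_of_analyticOnNhd_ball hR hΦa) X

end Analytic

end Summit.QuantumFields.BalabanUV.T4Continuum.ShellMeasureAverageDerivativeChart

end
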